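import Summits.ResolutionOfSingularities.ResolutionOfSingularities.Theorems.FrobeniusClosingSteerGrConeQuotient
import HarnessLib

/-!
# Crux `Steer` (stmt-ResolutionOfSingularities-16345), chain W4.1 — K-β0(b) gr bridge, brick (G4):
# the SHADOW of the previous stage on the next member (abstract chart map): `φ(F(x,y,z,w)) = x₁^d · F‴(v₁, z₁, w₁)`

OURS (campaign `res-hironaka`, rung L ★L-G4, slot W4.1; seat res-L0-w41-stub-4 g7 on res-L0-w41-plan-1 RULINGS 268(a)/282(f)/288(e)). Replaces the
role of no printed item; NOT a statement of the manuscript under review [claim: Hironaka2017, status: under-review]; AI-produced, weaker than expert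
review. Theses-free, definition-free, words-free.

This is the input side of `grConeTransport_pointStep` ((G3c)): along a ring map `φ : R → R′` with the x-chart substitutions at a RATIONAL point,
`φ x = x₁`, `φ y = x₁·(φ ã + v₁)`, `φ z = x₁ z₁`, `φ w = x₁ w₁` (`ã ∈ R` a lift of the chart point), a form `F` of degree `d` over `R` is carried to
`x₁^d · F‴(v₁, z₁, w₁)` where `F‴ := F(1, ã + T_V, T_Z, T_W) ∈ R[T_V, T_Z, T_W]` (dehomogenise at `X` and shift `Y` by the lift), read through `φ`.
* `eval_shadow_monomial`, **`map_eval_eq_pow_mul_eval_shadow`** — `φ (F(x,y,z,w)) = x₁^d · (F‴)^φ(v₁, z₁, w₁)`.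
* `totalDegree_shadow_le` — `deg F‴ ≤ d`; `eval_eq_sum_homogeneousComponent` — `F‴(y) = Σ_(j ≤ d) F‴_j(y)`.
* `coeff_map_unitOrMem` — over a LOCAL `R`, the coefficients of `(F‴_j)^φ` are units or lie in `φ(𝔪_R)·R′` (⊆ `x₁R′` at a point step).
* `homogeneousComponent_shadow_kill` — if `F = Ψ(Z,W) + X·A + Y·B` (the stage structure, `A, B` forms of degree `d−1`) then the `V`-free part
  of `F‴_d` is `Ψ`: `aeval (0, T_Z, T_W) F‴_d = Ψ`.
Together: the hypotheses `hF`, `hFc`, `hB`, `hFd` of `grConeTransport_pointStep` for `B := (F‴)^φ(v₁,z₁,w₁) + x₁·ρ`.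

[folklore]
bears_on: LADDER-RESOLUTION L ★L-G4 W4.1 (crux `Steer`, binder hK4ⁿᶜ, K-β0(b) `ArithTransportTwoN`, gr bridge (G4)).
-/

noncomputable section

-- `Summit.<S>.<S>.…` duplicates the summit name by design (single-problem summit).
set_option linter.dupNamespace false

open IsLocalRing MvPolynomial

namespace Summit.ResolutionOfSingularities.ResolutionOfSingularities.Theorems.SwitchingDichotomy.NearPoint

universe u

section Shadow
variable {R R' : Type u} [CommRing R] [CommRing R'] (φ : R →+* R') (atil : R) (x y z w : R) (x₁ v₁ z₁ w₁ : R')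
  (hx : φ x = x₁) (hy : φ y = x₁ * (φ atil + v₁)) (hz : φ z = x₁ * z₁) (hw : φ w = x₁ * w₁)

/-- The shadow substitution `X ↦ 1`, `Y ↦ ã + T_V`, `Z ↦ T_Z`, `W ↦ T_W`, monomial by monomial, read through `φ` at `(v₁, z₁, w₁)`. -/
theorem eval_map_aeval_shadow_monomial (m : Fin 4 →₀ ℕ) (c : R) :
    eval ![v₁, z₁, w₁] (MvPolynomial.map φ (aeval (![1, C atil + X 0, X 1, X 2] : Fin 4 → MvPolynomial (Fin 3) R) (monomial m c))) =
      φ c * ((φ atil + v₁) ^ (m 1) * z₁ ^ (m 2) * w₁ ^ (m 3)) := by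
  rw [aeval_monomial, map_mul, map_mul, MvPolynomial.algebraMap_eq, map_C, eval_C,
    Finsupp.prod_fintype _ _ (fun i => by rw [pow_zero]), map_prod, map_prod, Fin.prod_univ_four]
  simp [map_pow]

include hx hy hz hw in
/-- **`φ (F(x, y, z, w)) = x₁^d · (F‴)^φ(v₁, z₁, w₁)`** for a form `F` of degree `d`. -/
theorem map_eval_eq_pow_mul_eval_shadow (d : ℕ) (F : MvPolynomial (Fin 4) R) (hF : F.IsHomogeneous d) :
    φ (eval ![x, y, z, w] F) = x₁ ^ d *
      eval ![v₁, z₁, w₁] (MvPolynomial.map φ (aeval (![1, C atil + X 0, X 1, X 2] : Fin 4 → MvPolynomial (Fin 3) R) F)) := by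
  classical
  conv_lhs => rw [F.as_sum]
  conv_rhs => rw [F.as_sum]
  rw [map_sum, map_sum, map_sum, map_sum, map_sum, Finset.mul_sum]
  refine Finset.sum_congr rfl fun m hm => ?_
  have hdeg : m 0 + m 1 + m 2 + m 3 = d := by
    have h1 : m.degree = d := by rw [Finsupp.degree_eq_weight_one]; exact hF (mem_support_iff.mp hm)
    rwa [Finsupp.degree_eq_sum, Fin.sum_univ_four] at h1
  rw [eval_map_aeval_shadow_monomial, eval_monomial, Finsupp.prod_fintype _ _ (fun i => by rw [pow_zero]), map_mul, map_prod,
    Fin.prod_univ_four]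
  simp only [map_pow, Matrix.cons_val_zero, Matrix.cons_val_one, Matrix.cons_val_two, Matrix.cons_val]
  have h2 : (Matrix.vecHead (Matrix.vecTail ![y, z, w])) = z := rfl
  rw [h2, hx, hy, hz, hw, ← hdeg, mul_pow, mul_pow, mul_pow]
  ring

end Shadow

section Degrees
variable {R : Type u} [CommRing R]

/-- **Substituting polynomials of total degree `≤ 1` does not raise the total degree.** -/
theorem totalDegree_aeval_le_of_le_one {σ τ : Type*} (g : σ → MvPolynomial τ R) (hg : ∀ i, (g i).totalDegree ≤ 1) (P : MvPolynomial σ R) :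
    (aeval g P).totalDegree ≤ P.totalDegree := by
  classical
  conv_lhs => rw [P.as_sum]
  rw [map_sum]
  refine (totalDegree_finsetSum _ _).trans (Finset.sup_le fun m hm => ?_)
  rw [aeval_monomial, MvPolynomial.algebraMap_eq]
  refine (totalDegree_mul _ _).trans ?_
  rw [totalDegree_C, zero_add]
  refine (totalDegree_finsetProd _ _).trans ?_
  have h1 : ∑ i ∈ m.support, (g i ^ m i).totalDegree ≤ ∑ i ∈ m.support, m i :=
    Finset.sum_le_sum fun i _ => (totalDegree_pow _ _).trans (by simpa using Nat.mul_le_mul_left (m i) (hg i))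
  refine h1.trans ?_
  have h2 : ∑ i ∈ m.support, m i = (m.sum fun _ e => e) := rfl
  rw [h2]
  exact le_totalDegree hm

/-- The shadow substitution `(1, C ã + T_V, T_Z, T_W)` has entries of total degree `≤ 1`. -/
theorem totalDegree_shadow_entry_le [Nontrivial R] (atil : R) :
    ∀ i, ((![1, C atil + X 0, X 1, X 2] : Fin 4 → MvPolynomial (Fin 3) R) i).totalDegree ≤ 1 := by
  intro i
  fin_cases i
  · simp
  · refine (totalDegree_add _ _).trans ?_
    simp [totalDegree_C, totalDegree_X]
  · simp [totalDegree_X]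
  · simp [totalDegree_X]

/-- The killed shadow substitution `(1, C ã, T_Z, T_W)` has entries of total degree `≤ 1`. -/
theorem totalDegree_shadowKill_entry_le [Nontrivial R] (atil : R) :
    ∀ i, ((![1, C atil, X 0, X 1] : Fin 4 → MvPolynomial (Fin 2) R) i).totalDegree ≤ 1 := by
  intro i
  fin_cases i <;> simp [totalDegree_C, totalDegree_X]

/-- **A polynomial of total degree `< J` is the sum of its homogeneous components below `J`.** -/
theorem sum_homogeneousComponent_range {σ : Type*} (J : ℕ) (P : MvPolynomial σ R) (hJ : P.totalDegree < J) :
    ∑ j ∈ Finset.range J, homogeneousComponent j P = P := by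
  classical
  conv_rhs => rw [← sum_homogeneousComponent (φ := P)]
  symm
  refine Finset.sum_subset (Finset.range_subset_range.mpr (by omega)) fun j hj hj' => ?_
  apply homogeneousComponent_eq_zero
  rw [Finset.mem_range] at hj hj'
  omega

end Degrees

section ShadowData
variable {R R' : Type u} [CommRing R] [IsLocalRing R] [CommRing R'] (φ : R →+* R') (atil : R)

/-- **Coefficients coming from a LOCAL ring through `φ` are units or lie in `φ(𝔪_R)·R′`.** -/
theorem coeff_map_unitOrMem {σ : Type*} (P : MvPolynomial σ R) (m : σ →₀ ℕ) :
    IsUnit (coeff m (MvPolynomial.map φ P)) ∨ coeff m (MvPolynomial.map φ P) ∈ (maximalIdeal R).map φ := by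
  rw [coeff_map]
  by_cases h : IsUnit (coeff m P)
  · exact Or.inl (h.map φ)
  · exact Or.inr (Ideal.mem_map_of_mem φ ((mem_maximalIdeal _).mpr h))

/-- **The `V`-free part of the degree-`d` shadow component is the previous cone `Ψ`** when `F = Ψ(Z,W) + X·A + Y·B` with `A, B` of total
degree `≤ d − 1` (`1 ≤ d`): killing `V` in `F‴ = F(1, ã + V, Z, W)` gives `F(1, ã, Z, W) = Ψ + A(1,ã,Z,W) + ã·B(1,ã,Z,W)`, whose degree-`d`
component is `Ψ`. -/
theorem kill_homogeneousComponent_shadow (d : ℕ) (hd : 1 ≤ d) (Ψ : MvPolynomial (Fin 2) R) (hΨ : Ψ.IsHomogeneous d)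
    (A B : MvPolynomial (Fin 4) R) (hA : A.totalDegree ≤ d - 1) (hB : B.totalDegree ≤ d - 1) :
    aeval (![0, X 0, X 1] : Fin 3 → MvPolynomial (Fin 2) R)
        (homogeneousComponent d (aeval (![1, C atil + X 0, X 1, X 2] : Fin 4 → MvPolynomial (Fin 3) R)
          (rename (fun i : Fin 2 => (i.succ.succ : Fin 4)) Ψ + X 0 * A + X 1 * B))) = Ψ := by
  classical
  -- killing `V` commutes with taking the degree-`d` component for this substitution
  have hcomm : ∀ P : MvPolynomial (Fin 3) R,
      aeval (![0, X 0, X 1] : Fin 3 → MvPolynomial (Fin 2) R) (homogeneousComponent d P) =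
        homogeneousComponent d (aeval (![0, X 0, X 1] : Fin 3 → MvPolynomial (Fin 2) R) P) := by
    intro P
    conv_lhs => rw [P.as_sum]
    conv_rhs => rw [P.as_sum]
    rw [map_sum, map_sum, map_sum, map_sum]
    refine Finset.sum_congr rfl fun m _ => ?_
    -- one monomial
    have hmono : aeval (![0, X 0, X 1] : Fin 3 → MvPolynomial (Fin 2) R) (monomial m (coeff m P)) =
        if m 0 = 0 then monomial (Finsupp.single 0 (m 1) + Finsupp.single 1 (m 2)) (coeff m P) else 0 := by
      rw [aeval_monomial, MvPolynomial.algebraMap_eq, Finsupp.prod_fintype _ _ (fun i => by rw [pow_zero]), Fin.prod_univ_three]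
      simp only [Matrix.cons_val_zero, Matrix.cons_val_one, Matrix.cons_val_two]
      have h2 : (Matrix.vecHead (Matrix.vecTail ![(X 0 : MvPolynomial (Fin 2) R), X 1])) = X 1 := rfl
      rw [h2]
      by_cases h0 : m 0 = 0
      · rw [if_pos h0, h0, pow_zero, one_mul, X_pow_eq_monomial, X_pow_eq_monomial, monomial_mul, C_mul_monomial, mul_one, mul_one]
      · rw [if_neg h0, zero_pow h0, zero_mul, zero_mul, mul_zero]
    by_cases h0 : m 0 = 0
    · have hdegm : m.degree = m 1 + m 2 := by rw [Finsupp.degree_eq_sum, Fin.sum_univ_three, h0, zero_add]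
      have hhom : (monomial (Finsupp.single (0 : Fin 2) (m 1) + Finsupp.single 1 (m 2)) (coeff m P)).IsHomogeneous (m 1 + m 2) := by
        refine isHomogeneous_monomial _ ?_
        rw [Finsupp.degree_eq_sum, Fin.sum_univ_two]
        simp
      rw [homogeneousComponent_of_mem (isHomogeneous_monomial (coeff m P) rfl), hmono, if_pos h0,
        homogeneousComponent_of_mem hhom, hdegm]
      by_cases hd' : d = m 1 + m 2
      · rw [if_pos hd', if_pos hd', hmono, if_pos h0]
      · rw [if_neg hd', if_neg hd', map_zero]
    · rw [hmono, if_neg h0, map_zero, homogeneousComponent_of_mem (isHomogeneous_monomial (coeff m P) rfl)]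
      by_cases hd' : d = m.degree
      · rw [if_pos hd', hmono, if_neg h0]
      · rw [if_neg hd', map_zero]
  rw [hcomm, comp_aeval_apply]
  have hsub : (fun i => aeval (![0, X 0, X 1] : Fin 3 → MvPolynomial (Fin 2) R)
      ((![1, C atil + X 0, X 1, X 2] : Fin 4 → MvPolynomial (Fin 3) R) i)) = ![1, C atil, X 0, X 1] := by
    funext i; fin_cases i <;> simp
  rw [hsub]
  have hΨ' : aeval ((![1, C atil, X 0, X 1] : Fin 4 → MvPolynomial (Fin 2) R) ∘ fun i : Fin 2 => (i.succ.succ : Fin 4)) Ψ = Ψ := by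
    have : ((![1, C atil, X 0, X 1] : Fin 4 → MvPolynomial (Fin 2) R) ∘ fun i : Fin 2 => (i.succ.succ : Fin 4)) = X := by
      funext i; fin_cases i <;> rfl
    rw [this, aeval_X_left]; rfl
  have hev : aeval (![1, C atil, X 0, X 1] : Fin 4 → MvPolynomial (Fin 2) R)
      (rename (fun i : Fin 2 => (i.succ.succ : Fin 4)) Ψ + X 0 * A + X 1 * B) =
      Ψ + (aeval (![1, C atil, X 0, X 1] : Fin 4 → MvPolynomial (Fin 2) R) A +
        C atil * aeval (![1, C atil, X 0, X 1] : Fin 4 → MvPolynomial (Fin 2) R) B) := by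
    rw [map_add, map_add, map_mul, map_mul, aeval_X, aeval_X, aeval_rename, hΨ']
    simp only [Matrix.cons_val_zero, Matrix.cons_val_one]
    rw [one_mul, add_assoc]
  rw [hev, map_add, map_add, homogeneousComponent_eq_self hΨ]
  haveI : Nontrivial R := inferInstance
  have hA' : (aeval (![1, C atil, X 0, X 1] : Fin 4 → MvPolynomial (Fin 2) R) A).totalDegree < d :=
    lt_of_le_of_lt ((totalDegree_aeval_le_of_le_one _ (totalDegree_shadowKill_entry_le atil) A).trans hA) (by omega)
  have hB' : (C atil * aeval (![1, C atil, X 0, X 1] : Fin 4 → MvPolynomial (Fin 2) R) B).totalDegree < d := by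
    refine lt_of_le_of_lt ((totalDegree_mul _ _).trans ?_) (show d - 1 < d by omega)
    rw [totalDegree_C, zero_add]
    exact (totalDegree_aeval_le_of_le_one _ (totalDegree_shadowKill_entry_le atil) B).trans hB
  rw [homogeneousComponent_eq_zero _ _ hA', homogeneousComponent_eq_zero _ _ hB', add_zero, add_zero]

end ShadowData


section Stage
variable {R : Type u} [CommRing R] [IsLocalRing R] (x y z w : R) (hspan : Ideal.span (Set.range ![x, y, z, w]) = maximalIdeal R)

include hspan in
/-- **The stage congruence as ONE form of degree `d`**: `f ≡ Ψ(z,w) (mod (x,y)·𝔪^(d−1) + 𝔪^(d+1))` gives `f ≡ F(x,y,z,w) (mod 𝔪^(d+1))` with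
`F = Ψ(Z,W) + X·A + Y·B`, `A, B` forms of degree `d − 1`. -/
theorem exists_stage_form {d : ℕ} (hd : 1 ≤ d) (Ψ : MvPolynomial (Fin 2) R) (hΨ : Ψ.IsHomogeneous d) (f : R)
    (hf : f - eval ![z, w] Ψ ∈ Ideal.span {x, y} * maximalIdeal R ^ (d - 1) ⊔ maximalIdeal R ^ (d + 1)) :
    ∃ A B : MvPolynomial (Fin 4) R, A.IsHomogeneous (d - 1) ∧ B.IsHomogeneous (d - 1) ∧
      (rename (fun i : Fin 2 => (i.succ.succ : Fin 4)) Ψ + X 0 * A + X 1 * B).IsHomogeneous d ∧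
      f - eval ![x, y, z, w] (rename (fun i : Fin 2 => (i.succ.succ : Fin 4)) Ψ + X 0 * A + X 1 * B) ∈ maximalIdeal R ^ (d + 1) := by
  obtain ⟨p, hp, q, hq, hpq⟩ := Submodule.mem_sup.mp hf
  have hsplit : Ideal.span ({x, y} : Set R) * maximalIdeal R ^ (d - 1) =
      Ideal.span {x} * maximalIdeal R ^ (d - 1) ⊔ Ideal.span {y} * maximalIdeal R ^ (d - 1) := by
    rw [Ideal.span_insert, Ideal.sup_mul]
  rw [hsplit] at hp
  obtain ⟨px, hpx, py, hpy, hpxy⟩ := Submodule.mem_sup.mp hp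
  obtain ⟨mx, hmx, hxm⟩ := Ideal.mem_span_singleton_mul.mp hpx
  obtain ⟨my, hmy, hym⟩ := Ideal.mem_span_singleton_mul.mp hpy
  rw [← hspan] at hmx hmy
  obtain ⟨A, hA, hAe⟩ := Literature.AlgebraicGeometry.Resolution.exists_isHomogeneous_of_mem_span_pow _ (d - 1) hmx
  obtain ⟨B, hB, hBe⟩ := Literature.AlgebraicGeometry.Resolution.exists_isHomogeneous_of_mem_span_pow _ (d - 1) hmy
  have hΨ' : (rename (fun i : Fin 2 => (i.succ.succ : Fin 4)) Ψ).IsHomogeneous d := hΨ.rename_isHomogeneous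
  have hXA : (X (0 : Fin 4) * A : MvPolynomial (Fin 4) R).IsHomogeneous d := by
    have := (isHomogeneous_X R (0 : Fin 4)).mul hA; rwa [show 1 + (d - 1) = d by omega] at this
  have hYB : (X (1 : Fin 4) * B : MvPolynomial (Fin 4) R).IsHomogeneous d := by
    have := (isHomogeneous_X R (1 : Fin 4)).mul hB; rwa [show 1 + (d - 1) = d by omega] at this
  refine ⟨A, B, hA, hB, (hΨ'.add hXA).add hYB, ?_⟩
  have hev : eval ![x, y, z, w] (rename (fun i : Fin 2 => (i.succ.succ : Fin 4)) Ψ + X 0 * A + X 1 * B) =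
      eval ![z, w] Ψ + (px + py) := by
    have hcomp : ((![x, y, z, w] : Fin 4 → R) ∘ fun i : Fin 2 => (i.succ.succ : Fin 4)) = ![z, w] := by
      funext i; fin_cases i <;> rfl
    rw [map_add, map_add, map_mul, map_mul, eval_X, eval_X, hAe, hBe, eval_rename, hcomp]
    simp only [Matrix.cons_val_zero, Matrix.cons_val_one]
    rw [hxm, hym, add_assoc]
  rw [hev, hpxy, show f - (eval ![z, w] Ψ + p) = f - eval ![z, w] Ψ - p by ring, ← hpq, add_sub_cancel_left]
  exact hq

end Stage

section Package
variable {R R' : Type u} [CommRing R] [IsLocalRing R] [CommRing R'] [IsLocalRing R'] (φ : R →+* R') (atil : R) (x y z w : R)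
  (x₁ v₁ z₁ w₁ : R') (hx : φ x = x₁) (hy : φ y = x₁ * (φ atil + v₁)) (hz : φ z = x₁ * z₁) (hw : φ w = x₁ * w₁)
  (hspan : Ideal.span (Set.range ![x, y, z, w]) = maximalIdeal R)

omit [IsLocalRing R'] in
include hx hy hz hw hspan in
/-- At a point step the previous maximal ideal goes into `x₁R′`. -/
theorem map_maximalIdeal_le : (maximalIdeal R).map φ ≤ Ideal.span {x₁} := by
  rw [← hspan, Ideal.map_span, Ideal.span_le]
  rintro _ ⟨t, ⟨i, rfl⟩, rfl⟩
  fin_cases i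
  · change φ x ∈ _; rw [hx]; exact Ideal.subset_span rfl
  · change φ y ∈ _; rw [hy]; exact Ideal.mul_mem_right _ _ (Ideal.subset_span rfl)
  · change φ z ∈ _; rw [hz]; exact Ideal.mul_mem_right _ _ (Ideal.subset_span rfl)
  · change φ w ∈ _; rw [hw]; exact Ideal.mul_mem_right _ _ (Ideal.subset_span rfl)

omit [IsLocalRing R'] in
include hx hy hz hw hspan in
/-- **THE SHADOW DATA of `grConeTransport_pointStep`** produced from the previous stage: for a form `F` of degree `d` with
`f ≡ F(x,y,z,w) (mod 𝔪^(d+1))`, with `F‴ := F(1, ã + V, Z, W)` and `G_j := (F‴_j)^φ`: `φ f = x₁^d · B` where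
`B ≡ Σ_(j ≤ d) G_j(v₁, z₁, w₁) (mod x₁)`, each `G_j` is a form of degree `j` whose coefficients are units or multiples of `x₁`. -/
theorem exists_shadow (d : ℕ) (F : MvPolynomial (Fin 4) R) (hF : F.IsHomogeneous d) (f : R)
    (hf : f - eval ![x, y, z, w] F ∈ maximalIdeal R ^ (d + 1)) :
    ∃ B : R', φ f = x₁ ^ d * B ∧
      B - ∑ j ∈ Finset.range (d + 1), eval ![v₁, z₁, w₁]
          (MvPolynomial.map φ (homogeneousComponent j (aeval (![1, C atil + X 0, X 1, X 2] : Fin 4 → MvPolynomial (Fin 3) R) F))) ∈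
        Ideal.span {x₁} ∧
      (∀ j, (MvPolynomial.map φ (homogeneousComponent j (aeval (![1, C atil + X 0, X 1, X 2] : Fin 4 → MvPolynomial (Fin 3) R) F))).IsHomogeneous j) ∧
      (∀ j m, IsUnit (coeff m (MvPolynomial.map φ (homogeneousComponent j
          (aeval (![1, C atil + X 0, X 1, X 2] : Fin 4 → MvPolynomial (Fin 3) R) F)))) ∨
        coeff m (MvPolynomial.map φ (homogeneousComponent j (aeval (![1, C atil + X 0, X 1, X 2] : Fin 4 → MvPolynomial (Fin 3) R) F))) ∈
          Ideal.span {x₁}) := by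
  classical
  set F3 := aeval (![1, C atil + X 0, X 1, X 2] : Fin 4 → MvPolynomial (Fin 3) R) F with hF3
  have hle := map_maximalIdeal_le φ atil x y z w x₁ v₁ z₁ w₁ hx hy hz hw hspan
  -- the remainder goes into `x₁^(d+1) R′`
  have hr : φ (f - eval ![x, y, z, w] F) ∈ Ideal.span {x₁ ^ (d + 1)} := by
    have h := Ideal.mem_map_of_mem φ hf
    rw [Ideal.map_pow] at h
    have h2 := Ideal.pow_right_mono hle (d + 1) h
    rwa [Ideal.span_singleton_pow] at h2
  obtain ⟨ρ, hρ⟩ := Ideal.mem_span_singleton'.mp hr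
  -- the form part
  have hmain := map_eval_eq_pow_mul_eval_shadow φ atil x y z w x₁ v₁ z₁ w₁ hx hy hz hw d F hF
  have hdeg : F3.totalDegree < d + 1 := by
    haveI : Nontrivial R := inferInstance
    exact Nat.lt_succ_of_le ((totalDegree_aeval_le_of_le_one _ (totalDegree_shadow_entry_le atil) F).trans (hF.totalDegree_le))
  have hsum : eval ![v₁, z₁, w₁] (MvPolynomial.map φ F3) =
      ∑ j ∈ Finset.range (d + 1), eval ![v₁, z₁, w₁] (MvPolynomial.map φ (homogeneousComponent j F3)) := by
    conv_lhs => rw [← sum_homogeneousComponent_range (d + 1) F3 hdeg]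
    rw [map_sum, map_sum]
  refine ⟨eval ![v₁, z₁, w₁] (MvPolynomial.map φ F3) + x₁ * ρ, ?_, ?_, fun j => (homogeneousComponent_isHomogeneous j F3).map φ,
    fun j m => ?_⟩
  · have : φ f = φ (eval ![x, y, z, w] F) + φ (f - eval ![x, y, z, w] F) := by rw [map_sub, add_sub_cancel]
    rw [this, hmain, ← hρ]
    ring
  · rw [hsum, add_sub_cancel_left]
    exact Ideal.mul_mem_right _ _ (Ideal.subset_span rfl)
  · rcases coeff_map_unitOrMem φ (homogeneousComponent j F3) m with h | h
    · exact Or.inl h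
    · exact Or.inr (hle h)

/-- **… and its `V`-free degree-`d` part is the previous cone, read through `residue′ ∘ φ`**: for `F = Ψ(Z,W) + X·A + Y·B`. -/
theorem kill_map_residue_shadow (d : ℕ) (hd : 1 ≤ d) (Ψ : MvPolynomial (Fin 2) R) (hΨ : Ψ.IsHomogeneous d)
    (A B : MvPolynomial (Fin 4) R) (hA : A.IsHomogeneous (d - 1)) (hB : B.IsHomogeneous (d - 1)) :
    aeval (![0, X 0, X 1] : Fin 3 → MvPolynomial (Fin 2) (ResidueField R'))
        (MvPolynomial.map (residue R') (MvPolynomial.map φ (homogeneousComponent d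
          (aeval (![1, C atil + X 0, X 1, X 2] : Fin 4 → MvPolynomial (Fin 3) R)
            (rename (fun i : Fin 2 => (i.succ.succ : Fin 4)) Ψ + X 0 * A + X 1 * B))))) =
      MvPolynomial.map ((residue R').comp φ) Ψ := by
  rw [MvPolynomial.map_map, aeval_eq_bind₁, ← map_bind₁_kill, ← aeval_eq_bind₁,
    kill_homogeneousComponent_shadow atil d hd Ψ hΨ A B hA.totalDegree_le hB.totalDegree_le]

end Package

end Summit.ResolutionOfSingularities.ResolutionOfSingularities.Theorems.SwitchingDichotomy.NearPoint

end
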